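import Mathlib
import Literature.NumberTheory.NumberFields.PureCubicNormCubicResidue
import Literature.NumberTheory.NumberFields.ClassGroupPrimesAvoiding
import HarnessLib

/-!
# Pure cubic fields: the rational genus characters `𝔞 ↦ (N𝔞 mod ℓ) ∈ (ℤ/ℓ)ˣ/(ℤ/ℓ)ˣ³` (Barrucand–Cohn)

Topic `NumberTheory/NumberFields`.  Theorem-only file (no definition, no named fact, D-0026),
unconditional; continuation of `PureCubicNormCubicResidue.lean` (Ishida's Lemma 4:
`N(γ) ≡ c³ (mod ℓ)` for `γ ∈ 𝓞_K`, `K ∋ ∛m` cubic, `3 ∤ v_ℓ(m)`).  For a finite set `S` of such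
primes `ℓ` the norm residues of ideals prime to `S` define a homomorphism on the CLASS GROUP:

> P. Barrucand, H. Cohn, *A rational genus, class number divisibility, and unit theory for pure
> cubic fields*, J. Number Theory 2 (1970) 7–21: the genus of an ideal `𝔞` of `ℚ(∛m)` prime to
> the discriminant is determined by the cubic residue characters of the rational integer `N𝔞`
> modulo the primes `p ≡ 1 (mod 3)` dividing `m` ("rational genus"); M. Ishida, LNM 555 (1976),
> Ch. 2 Lemma 4 and Ch. 4 (the genus characters `ω_p ∘ N_{K/ℚ}`).

* `Honda1971.natCast_mem_of_dvd_absNorm`, `Honda1971.exists_mk0_eq_forall_not_dvd_absNorm` —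
  every ideal class of a number field contains an integral ideal of norm prime to any finite set
  of rational primes (from the tree's `ClassGroup.mem_closure_mk0_prime_not_mem`);
* `Honda1971.quotient_mk_eq_of_mk0_eq` — **the norm residue class `N𝔞 ∈ (ℤ/ℓ)ˣ/(ℤ/ℓ)ˣ³` depends
  only on the ideal class of `𝔞`** (for `𝔞` prime to `ℓ`): if `[𝔞] = [𝔟]` then
  `𝔞 𝔟^{3h−1} = (γ)` is principal and `N𝔞 · N𝔟^{3h−1} = |N(γ)| ≡ ±c³`;
* `Honda1971.exists_rationalGenusHom` — **the rational genus homomorphism**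
  `G : Cl(K) → ∏_{ℓ ∈ S} (ℤ/ℓ)ˣ/(ℤ/ℓ)ˣ³` with `G([𝔞])_ℓ = N𝔞 mod (ℤ/ℓ)ˣ³` for every ideal `𝔞`
  prime to `ℓ`.  (Its surjectivity — via degree-one primes in arithmetic progressions — and the
  resulting class-field-theory-free proof of `3^{#S} ∣ h(K)` are in
  `PureCubicRationalGenusSurjective.lean`.)

## References

* P. Barrucand, H. Cohn, J. Number Theory 2 (1970) 7–21. [BarrucandCohn1970]
* M. Ishida, *The genus fields of algebraic number fields*, LNM 555 (1976), Ch. 2 Lemma 4, Ch. 4. [Ishida1976]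
* J. Neukirch, *Algebraic Number Theory* (1999), Ch. VI §1 (every class contains an ideal prime to a
  given ideal). [NeukirchANT1999]
-/

noncomputable section

open Polynomial NumberField IsDedekindDomain
open scoped IntermediateField nonZeroDivisors

namespace Literature.NumberTheory.NumberFields

namespace Honda1971

variable {K : Type*} [Field K] [NumberField K]

/-! ### Integral representatives of norm prime to `S` -/

/-- A maximal ideal whose norm is divisible by the rational prime `ℓ` contains `ℓ` (its norm is a
power of the prime below it). [folklore] -/
theorem natCast_mem_of_dvd_absNorm {ℓ : ℕ} (hℓ : ℓ.Prime) (v : HeightOneSpectrum (𝓞 K))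
    (h : ℓ ∣ Ideal.absNorm v.asIdeal) : (ℓ : 𝓞 K) ∈ v.asIdeal := by
  classical
  haveI := v.isMaximal
  have hne : v.asIdeal ≠ ⊥ := v.ne_bot
  haveI : Finite (𝓞 K ⧸ v.asIdeal) := Ideal.finiteQuotientOfFreeOfNeBot v.asIdeal hne
  letI : Field (𝓞 K ⧸ v.asIdeal) := Ideal.Quotient.field v.asIdeal
  obtain ⟨q, hqchar⟩ := CharP.exists (𝓞 K ⧸ v.asIdeal)
  haveI := hqchar
  have hqprime : q.Prime := CharP.char_is_prime (𝓞 K ⧸ v.asIdeal) q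
  have hqv : (q : 𝓞 K) ∈ v.asIdeal := by
    rw [← Ideal.Quotient.eq_zero_iff_mem, map_natCast]
    exact CharP.cast_eq_zero (𝓞 K ⧸ v.asIdeal) q
  haveI : v.asIdeal.LiesOver (Ideal.span {(q : ℤ)}) := ⟨(under_int_eq_span hqprime v hqv).symm⟩
  have hnorm : q ^ v.asIdeal.inertiaDeg ℤ = Ideal.absNorm v.asIdeal := Ideal.pow_inertiaDeg q v.asIdeal
  rw [← hnorm] at h
  have hℓq : ℓ = q := (Nat.prime_dvd_prime_iff_eq hℓ hqprime).mp (hℓ.dvd_of_dvd_pow h)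
  subst hℓq
  exact hqv

/-- The primes of `𝓞 K` containing one of finitely many rational primes form a finite set.
[folklore] -/
theorem finite_setOf_exists_natCast_mem (S : Finset ℕ) (hS : ∀ ℓ ∈ S, ℓ.Prime) :
    {v : HeightOneSpectrum (𝓞 K) | ∃ ℓ ∈ S, (ℓ : 𝓞 K) ∈ v.asIdeal}.Finite := by
  classical
  have hsub : {v : HeightOneSpectrum (𝓞 K) | ∃ ℓ ∈ S, (ℓ : 𝓞 K) ∈ v.asIdeal} ⊆
      ⋃ ℓ ∈ S, {v : HeightOneSpectrum (𝓞 K) | (ℓ : 𝓞 K) ∈ v.asIdeal} := by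
    intro v hv
    obtain ⟨ℓ, hℓS, hℓv⟩ := hv
    exact Set.mem_biUnion hℓS hℓv
  refine Set.Finite.subset (Set.Finite.biUnion S.finite_toSet fun ℓ hℓS => ?_) hsub
  have hℓ := hS ℓ hℓS
  haveI hmax : (Ideal.span {(ℓ : ℤ)}).IsMaximal :=
    Ideal.IsPrime.isMaximal
      ((Ideal.span_singleton_prime (by exact_mod_cast hℓ.ne_zero)).mpr
        (Nat.prime_iff_prime_int.mp hℓ)) (by simpa using hℓ.ne_zero)
  have hfin := IsDedekindDomain.primesOver_finite (Ideal.span {(ℓ : ℤ)}) (𝓞 K)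
  refine Set.Finite.of_finite_image (f := fun v : HeightOneSpectrum (𝓞 K) => v.asIdeal)
    (hfin.subset ?_) ?_
  · rintro _ ⟨v, hv, rfl⟩
    haveI := v.isMaximal
    exact ⟨v.isPrime, ⟨(under_int_eq_span hℓ v hv).symm⟩⟩
  · intro v _ w _ h
    exact HeightOneSpectrum.ext h

/-- **Every ideal class contains an integral ideal of norm prime to a given finite set of rational
primes** (Neukirch VI §1; from the tree's "the classes of the primes outside a finite set generate
the class group", `ClassGroup.mem_closure_mk0_prime_not_mem`). [cite: NeukirchANT1999, Ch. VI §1] -/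
theorem exists_mk0_eq_forall_not_dvd_absNorm (S : Finset ℕ) (hS : ∀ ℓ ∈ S, ℓ.Prime)
    (c : ClassGroup (𝓞 K)) :
    ∃ I : (Ideal (𝓞 K))⁰, (∀ ℓ ∈ S, ¬ ℓ ∣ Ideal.absNorm (I : Ideal (𝓞 K))) ∧
      ClassGroup.mk0 I = c := by
  classical
  set T : Finset (HeightOneSpectrum (𝓞 K)) := (finite_setOf_exists_natCast_mem S hS).toFinset
    with hT
  have hmem := ClassGroup.mem_closure_mk0_prime_not_mem T c
  refine Subgroup.closure_induction (p := fun c _ => ∃ I : (Ideal (𝓞 K))⁰,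
      (∀ ℓ ∈ S, ¬ ℓ ∣ Ideal.absNorm (I : Ideal (𝓞 K))) ∧ ClassGroup.mk0 I = c)
    ?_ ?_ ?_ ?_ hmem
  · -- generators: primes outside `T`
    rintro _ ⟨v, hv, rfl⟩
    refine ⟨⟨v.asIdeal, mem_nonZeroDivisors_iff_ne_zero.mpr v.ne_bot⟩, fun ℓ hℓS hdvd => ?_, rfl⟩
    have hℓv := natCast_mem_of_dvd_absNorm (hS ℓ hℓS) v hdvd
    exact hv ((Set.Finite.mem_toFinset _).mpr ⟨ℓ, hℓS, hℓv⟩)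
  · exact ⟨1, fun ℓ hℓS hdvd => by
      rw [OneMemClass.coe_one, Ideal.one_eq_top, Ideal.absNorm_top, Nat.dvd_one] at hdvd
      exact (hS ℓ hℓS).one_lt.ne' hdvd, map_one _⟩
  · rintro x y - - ⟨I, hI, rfl⟩ ⟨J, hJ, rfl⟩
    refine ⟨I * J, fun ℓ hℓS hdvd => ?_, map_mul _ _ _⟩
    rw [Submonoid.coe_mul, map_mul] at hdvd
    rcases (Nat.Prime.dvd_mul (hS ℓ hℓS)).mp hdvd with h | h
    · exact hI ℓ hℓS h
    · exact hJ ℓ hℓS h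
  · rintro x - ⟨I, hI, rfl⟩
    -- `[I]⁻¹ = [I^(h-1)]`
    set N := Fintype.card (ClassGroup (𝓞 K)) with hN
    have hNpos : 0 < N := Fintype.card_pos
    refine ⟨I ^ (N - 1), fun ℓ hℓS hdvd => ?_, ?_⟩
    · rw [SubmonoidClass.coe_pow, map_pow] at hdvd
      exact hI ℓ hℓS ((hS ℓ hℓS).dvd_of_dvd_pow hdvd)
    · rw [map_pow, eq_inv_iff_mul_eq_one, ← pow_succ, Nat.sub_add_cancel hNpos, hN,
        pow_card_eq_one]

/-! ### The norm residue class modulo cubes depends only on the ideal class -/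

/-- From `ℓ ∣ n − c³` and `ℓ ∤ n`: `|n|` is a cube in `(ℤ/ℓ)ˣ` (`|n| = ±n = (±c)³`). [folklore] -/
theorem exists_units_pow_three_eq_natAbs {ℓ : ℕ} [Fact ℓ.Prime] {n c : ℤ}
    (h : (ℓ : ℤ) ∣ n - c ^ 3) (hn : ((n.natAbs : ℕ) : ZMod ℓ) ≠ 0) :
    ∃ w : (ZMod ℓ)ˣ, (w : ZMod ℓ) ^ 3 = (n.natAbs : ZMod ℓ) := by
  have hc : ((c : ZMod ℓ)) ^ 3 = (n : ZMod ℓ) := by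
    have h' := (ZMod.intCast_zmod_eq_zero_iff_dvd _ ℓ).mpr h
    push_cast at h'
    linear_combination -h'
  have hsign : (n : ZMod ℓ) = (n.natAbs : ZMod ℓ) ∨ (n : ZMod ℓ) = -(n.natAbs : ZMod ℓ) := by
    rcases Int.natAbs_eq n with h1 | h1
    · left
      exact (congrArg (fun z : ℤ => (z : ZMod ℓ)) h1).trans (Int.cast_natCast _)
    · right
      refine (congrArg (fun z : ℤ => (z : ZMod ℓ)) h1).trans ?_
      rw [Int.cast_neg, Int.cast_natCast]
  have hc0 : (c : ZMod ℓ) ≠ 0 := by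
    intro h0
    rw [h0, zero_pow (by norm_num)] at hc
    rcases hsign with h1 | h1
    · exact hn (h1 ▸ hc.symm)
    · apply hn
      have : (n.natAbs : ZMod ℓ) = -(n : ZMod ℓ) := by rw [h1, neg_neg]
      rw [this, ← hc, neg_zero]
  rcases hsign with h1 | h1
  · exact ⟨Units.mk0 _ hc0, by rw [Units.val_mk0, hc, h1]⟩
  · refine ⟨-Units.mk0 _ hc0, ?_⟩
    rw [Units.val_neg, Units.val_mk0, neg_pow, hc, h1]
    ring

/-- **The rational genus character is a class invariant.**  Let `K ∋ ∛m` be cubic, `ℓ` prime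
with `3 ∤ v_ℓ(m)`, and `𝔞, 𝔟` nonzero ideals prime to `ℓ` in the same ideal class.  Then `N𝔞` and
`N𝔟` have the same image in `(ℤ/ℓ)ˣ/(ℤ/ℓ)ˣ³`: indeed `𝔞 𝔟^{3h−1} = (γ)` is principal
(`h = #Cl(K)`), so `N𝔞 · N𝔟^{3h−1} = |N(γ)|` is a cube mod `ℓ` (Ishida's Lemma 4), and `N𝔟³` is a
cube. [cite: BarrucandCohn1970] [cite: Ishida1976, Ch. 2 Lemma 4] -/
theorem quotient_mk_eq_of_mk0_eq {ℓ m : ℕ} (hℓ : ℓ.Prime) (hm : ¬ 3 ∣ padicValNat ℓ m)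
    (h3 : Module.finrank ℚ K = 3) {α : K} (hα : α ^ 3 = (m : K)) {I J : (Ideal (𝓞 K))⁰}
    (hIJ : ClassGroup.mk0 I = ClassGroup.mk0 J) {uI uJ : (ZMod ℓ)ˣ}
    (huI : (uI : ZMod ℓ) = Ideal.absNorm (I : Ideal (𝓞 K)))
    (huJ : (uJ : ZMod ℓ) = Ideal.absNorm (J : Ideal (𝓞 K))) :
    (QuotientGroup.mk uI : (ZMod ℓ)ˣ ⧸ (powMonoidHom 3 : (ZMod ℓ)ˣ →* (ZMod ℓ)ˣ).range) =
      QuotientGroup.mk uJ := by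
  classical
  haveI : Fact ℓ.Prime := ⟨hℓ⟩
  set N := Fintype.card (ClassGroup (𝓞 K)) with hN
  have hNpos : 0 < N := Fintype.card_pos
  set n : ℕ := 3 * N - 1 with hn
  have hn1 : n + 1 = 3 * N := by omega
  -- `I J^n` is principal
  have hprinc : ClassGroup.mk0 (I * J ^ n) = 1 := by
    rw [map_mul, map_pow, hIJ, ← pow_succ', hn1, pow_mul', hN, pow_card_eq_one, one_pow]
  have hmem : ((I : Ideal (𝓞 K)) * (J : Ideal (𝓞 K)) ^ n) ∈ (Ideal (𝓞 K))⁰ := by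
    have := (I * J ^ n).2
    rwa [Submonoid.coe_mul, SubmonoidClass.coe_pow] at this
  have hprinc' : ((I : Ideal (𝓞 K)) * (J : Ideal (𝓞 K)) ^ n).IsPrincipal := by
    rw [← ClassGroup.mk0_eq_one_iff hmem]
    have : (⟨(I : Ideal (𝓞 K)) * (J : Ideal (𝓞 K)) ^ n, hmem⟩ : (Ideal (𝓞 K))⁰) = I * J ^ n :=
      Subtype.ext (by rw [Submonoid.coe_mul, SubmonoidClass.coe_pow])
    rw [this]; exact hprinc
  obtain ⟨γ, hγ⟩ := (Submodule.isPrincipal_iff _).mp hprinc'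
  -- norms: `N I · N J ^ n = |N γ|`
  have hnorm : Ideal.absNorm (I : Ideal (𝓞 K)) * Ideal.absNorm (J : Ideal (𝓞 K)) ^ n =
      (Algebra.norm ℤ γ).natAbs := by
    have h := congrArg Ideal.absNorm hγ
    rwa [map_mul, map_pow, Ideal.submodule_span_eq, Ideal.absNorm_span_singleton] at h
  -- `|N γ|` is a nonzero cube mod `ℓ`
  obtain ⟨c, hc⟩ := exists_natCast_dvd_norm_sub_pow_three hℓ hm h3 hα γ
  have hunit : ((uI * uJ ^ n : (ZMod ℓ)ˣ) : ZMod ℓ) = ((Algebra.norm ℤ γ).natAbs : ZMod ℓ) := by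
    rw [Units.val_mul, Units.val_pow_eq_pow_val, huI, huJ, ← Nat.cast_pow, ← Nat.cast_mul, hnorm]
  have hn0 : (((Algebra.norm ℤ γ).natAbs : ℕ) : ZMod ℓ) ≠ 0 := by
    rw [← hunit]; exact (uI * uJ ^ n).ne_zero
  obtain ⟨w, hw⟩ := exists_units_pow_three_eq_natAbs hc hn0
  have hrel : uI * uJ ^ n = w ^ 3 := Units.ext (by rw [hunit, Units.val_pow_eq_pow_val, hw])
  -- in the quotient by the cubes: `[uI] [uJ]^n = 1` and `[uJ]^3 = 1`
  set H := (powMonoidHom 3 : (ZMod ℓ)ˣ →* (ZMod ℓ)ˣ).range with hH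
  have h1 : (QuotientGroup.mk uI : (ZMod ℓ)ˣ ⧸ H) * (QuotientGroup.mk uJ) ^ n = 1 := by
    rw [← QuotientGroup.mk_pow, ← QuotientGroup.mk_mul, hrel, QuotientGroup.eq_one_iff]
    exact ⟨w, rfl⟩
  have h3' : (QuotientGroup.mk uJ : (ZMod ℓ)ˣ ⧸ H) ^ 3 = 1 := by
    rw [← QuotientGroup.mk_pow, QuotientGroup.eq_one_iff]
    exact ⟨uJ, rfl⟩
  have h2 : (QuotientGroup.mk uJ : (ZMod ℓ)ˣ ⧸ H) ^ (n + 1) = 1 := by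
    rw [hn1, pow_mul, h3', one_pow]
  calc (QuotientGroup.mk uI : (ZMod ℓ)ˣ ⧸ H)
      = (QuotientGroup.mk uI * (QuotientGroup.mk uJ) ^ n) * QuotientGroup.mk uJ := by
        rw [mul_assoc, ← pow_succ, h2, mul_one]
    _ = QuotientGroup.mk uJ := by rw [h1, one_mul]

/-! ### The rational genus homomorphism -/

/-- **The rational genus homomorphism (Barrucand–Cohn).**  Let `K` be a cubic number field
containing a cube root of `m` and `S` a finite set of primes `ℓ` with `3 ∤ v_ℓ(m)`.  There is a
group homomorphism `G : Cl(K) → ∏_{ℓ ∈ S} (ℤ/ℓ)ˣ/(ℤ/ℓ)ˣ³` such that for every nonzero ideal `𝔞`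
and every `ℓ ∈ S` not dividing `N𝔞`, the `ℓ`-component of `G([𝔞])` is the class of
`N𝔞 ∈ (ℤ/ℓ)ˣ` modulo cubes.  (Well defined by `quotient_mk_eq_of_mk0_eq`; defined everywhere
because every class contains an ideal of norm prime to `S`.) [cite: BarrucandCohn1970]
[cite: Ishida1976, Ch. 4] -/
theorem exists_rationalGenusHom {m : ℕ} (S : Finset ℕ)
    (hS : ∀ ℓ ∈ S, ℓ.Prime ∧ ¬ 3 ∣ padicValNat ℓ m)
    (K : Type*) [Field K] [NumberField K] (h3 : Module.finrank ℚ K = 3) {α : K}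
    (hα : α ^ 3 = (m : K)) :
    ∃ G : ClassGroup (𝓞 K) →*
        (Π ℓ : S, (ZMod (ℓ : ℕ))ˣ ⧸ (powMonoidHom 3 : (ZMod (ℓ : ℕ))ˣ →* (ZMod (ℓ : ℕ))ˣ).range),
      ∀ (I : (Ideal (𝓞 K))⁰) (ℓ : S) (u : (ZMod (ℓ : ℕ))ˣ),
        (u : ZMod (ℓ : ℕ)) = Ideal.absNorm (I : Ideal (𝓞 K)) →
          G (ClassGroup.mk0 I) ℓ = QuotientGroup.mk u := by
  classical
  have hSp : ∀ ℓ ∈ S, ℓ.Prime := fun ℓ h => (hS ℓ h).1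
  haveI hfact : ∀ ℓ : S, Fact (ℓ : ℕ).Prime := fun ℓ => ⟨hSp ℓ ℓ.2⟩
  -- representatives of norm prime to `S`
  have hR := fun c : ClassGroup (𝓞 K) => exists_mk0_eq_forall_not_dvd_absNorm S hSp c
  choose rep hrep_cop hrep_mk using hR
  -- the vector of norm residues modulo cubes of an ideal
  let nrm : Ideal (𝓞 K) →
      (Π ℓ : S, (ZMod (ℓ : ℕ))ˣ ⧸ (powMonoidHom 3 : (ZMod (ℓ : ℕ))ˣ →* (ZMod (ℓ : ℕ))ˣ).range) :=
    fun I ℓ => if h : ((Ideal.absNorm I : ℕ) : ZMod (ℓ : ℕ)) = 0 then 1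
      else QuotientGroup.mk (Units.mk0 _ h)
  have nrm_spec : ∀ (I : Ideal (𝓞 K)) (ℓ : S) (u : (ZMod (ℓ : ℕ))ˣ),
      (u : ZMod (ℓ : ℕ)) = Ideal.absNorm I → nrm I ℓ = QuotientGroup.mk u := by
    intro I ℓ u hu
    have h0 : ((Ideal.absNorm I : ℕ) : ZMod (ℓ : ℕ)) ≠ 0 := by rw [← hu]; exact u.ne_zero
    simp only [nrm, dif_neg h0]
    congr 1
    exact Units.ext (by rw [Units.val_mk0, hu])
  have unit_of_not_dvd : ∀ (I : Ideal (𝓞 K)) (ℓ : S), ¬ (ℓ : ℕ) ∣ Ideal.absNorm I →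
      ∃ u : (ZMod (ℓ : ℕ))ˣ, (u : ZMod (ℓ : ℕ)) = Ideal.absNorm I := by
    intro I ℓ h
    have h0 : ((Ideal.absNorm I : ℕ) : ZMod (ℓ : ℕ)) ≠ 0 := by
      rwa [Ne, ZMod.natCast_eq_zero_iff]
    exact ⟨Units.mk0 _ h0, Units.val_mk0 _⟩
  -- class invariance, componentwise
  have nrm_eq : ∀ (I J : (Ideal (𝓞 K))⁰) (ℓ : S), ¬ (ℓ : ℕ) ∣ Ideal.absNorm (I : Ideal (𝓞 K)) →
      ¬ (ℓ : ℕ) ∣ Ideal.absNorm (J : Ideal (𝓞 K)) → ClassGroup.mk0 I = ClassGroup.mk0 J →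
      nrm I ℓ = nrm J ℓ := by
    intro I J ℓ hI hJ hIJ
    obtain ⟨uI, huI⟩ := unit_of_not_dvd I ℓ hI
    obtain ⟨uJ, huJ⟩ := unit_of_not_dvd J ℓ hJ
    rw [nrm_spec I ℓ uI huI, nrm_spec J ℓ uJ huJ]
    exact quotient_mk_eq_of_mk0_eq (hSp ℓ ℓ.2) (hS ℓ ℓ.2).2 h3 hα hIJ huI huJ
  -- multiplicativity on ideals prime to `S`
  have nrm_mul : ∀ (I J : Ideal (𝓞 K)) (ℓ : S), ¬ (ℓ : ℕ) ∣ Ideal.absNorm I →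
      ¬ (ℓ : ℕ) ∣ Ideal.absNorm J → nrm (I * J) ℓ = nrm I ℓ * nrm J ℓ := by
    intro I J ℓ hI hJ
    obtain ⟨uI, huI⟩ := unit_of_not_dvd I ℓ hI
    obtain ⟨uJ, huJ⟩ := unit_of_not_dvd J ℓ hJ
    have huIJ : ((uI * uJ : (ZMod (ℓ : ℕ))ˣ) : ZMod (ℓ : ℕ)) = Ideal.absNorm (I * J) := by
      rw [Units.val_mul, huI, huJ, map_mul, Nat.cast_mul]
    rw [nrm_spec I ℓ uI huI, nrm_spec J ℓ uJ huJ, nrm_spec (I * J) ℓ (uI * uJ) huIJ,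
      QuotientGroup.mk_mul]
  have cop_mul : ∀ (I J : Ideal (𝓞 K)) (ℓ : S), ¬ (ℓ : ℕ) ∣ Ideal.absNorm I →
      ¬ (ℓ : ℕ) ∣ Ideal.absNorm J → ¬ (ℓ : ℕ) ∣ Ideal.absNorm (I * J) := by
    intro I J ℓ hI hJ h
    rw [map_mul] at h
    rcases (Nat.Prime.dvd_mul (hSp ℓ ℓ.2)).mp h with h' | h'
    · exact hI h'
    · exact hJ h'
  -- the homomorphism
  refine ⟨{ toFun := fun c => nrm (rep c)
            map_one' := ?_
            map_mul' := ?_ }, ?_⟩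
  · funext ℓ
    have h1 : nrm (rep 1) ℓ = nrm ((1 : (Ideal (𝓞 K))⁰) : Ideal (𝓞 K)) ℓ :=
      nrm_eq (rep 1) 1 ℓ (hrep_cop 1 ℓ ℓ.2) (by
        rw [OneMemClass.coe_one, Ideal.one_eq_top, Ideal.absNorm_top, Nat.dvd_one]
        exact (hSp ℓ ℓ.2).one_lt.ne') (by rw [hrep_mk, map_one])
    rw [h1, Pi.one_apply, nrm_spec _ ℓ 1 (by
      rw [OneMemClass.coe_one, Ideal.one_eq_top, Ideal.absNorm_top, Units.val_one, Nat.cast_one])]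
    rfl
  · intro a b
    funext ℓ
    rw [Pi.mul_apply]
    have h1 : nrm (rep (a * b)) ℓ = nrm ((rep a * rep b : (Ideal (𝓞 K))⁰) : Ideal (𝓞 K)) ℓ :=
      nrm_eq (rep (a * b)) (rep a * rep b) ℓ (hrep_cop _ ℓ ℓ.2) (by
        rw [Submonoid.coe_mul]
        exact cop_mul _ _ ℓ (hrep_cop a ℓ ℓ.2) (hrep_cop b ℓ ℓ.2)) (by
        rw [hrep_mk, map_mul, hrep_mk, hrep_mk])
    rw [h1, Submonoid.coe_mul, nrm_mul _ _ ℓ (hrep_cop a ℓ ℓ.2) (hrep_cop b ℓ ℓ.2)]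
  · intro I ℓ u hu
    have hI : ¬ (ℓ : ℕ) ∣ Ideal.absNorm (I : Ideal (𝓞 K)) := by
      intro h
      have h0 : ((Ideal.absNorm (I : Ideal (𝓞 K)) : ℕ) : ZMod (ℓ : ℕ)) = 0 :=
        (ZMod.natCast_eq_zero_iff _ _).mpr h
      exact u.ne_zero (hu.trans h0)
    change nrm (rep (ClassGroup.mk0 I)) ℓ = QuotientGroup.mk u
    rw [nrm_eq (rep (ClassGroup.mk0 I)) I ℓ (hrep_cop _ ℓ ℓ.2) hI (hrep_mk _)]
    exact nrm_spec I ℓ u hu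

end Honda1971

end Literature.NumberTheory.NumberFields

end
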